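import Summits.PneNP.PneNP.Theorems.SliceACZero.Negative.WindowDepth
import Literature.Computability.Complexity.CliqueThresholdBounds

/-!
# Negative lemmas for crux `SliceACZero` (stmt-PneNP-2835), Part VIII-E: the `q`-window of `Hyp` cannot
reach the subcritical densities `q·C(n,2) ≈ m · n^{-ε}`; global forms of the lower-edge statements

Hypothesis-side mirror of `WindowDepth.lean` (Part V, `not_innerConcLowWindow`): at the density
`q = m n^{-ε}/C(n,2)` the first moment (`gnpProb_clique_le`, `choose_mul_threshold_pow_le`, both in tree)
gives `Pr_{G(n,q)}[k-clique] ≤ (n^{-ε})^{C(k,2)} ≤ n^{-ε}`, so the constant-`0` circuit is `δ`-accurate and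
`n^c < 1` fails:

* `not_innerHypLowWindow` (`d ≥ 1`, every `c`, `k ≥ 2`, every `δ, ε > 0`);
* `not_hypLowWindow`, `not_concLowWindow` — the global statements with the lower window edge at
  `m · n^{-ε}` are false for every `ε > 0`.

Sorry-free, standard axioms; no Theses decl asserted positively. Refuter seat cdisprove-stmt-PneNP-2835
(gen 2), 2026-08-16.
-/

noncomputable section

namespace Summit.PneNP.PneNP.Theorems.SliceACZero.Negative

open Literature.Computability.Complexity Filter Finset
open scoped Topology

section LowWindowHyp

variable {n : ℕ}

/-- **The `q`-window of `Hyp` cannot reach the subcritical densities `qN ≈ m · n^{-ε}`** (`d ≥ 1`, every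
`c`, `k ≥ 2`, every `δ > 0`, `ε > 0`): there `Pr_{G(n,q)}[k-clique] ≤ n^{-ε} ≤ δ` eventually (first
moment), so the constant-`0` circuit (size `1`) is `δ`-accurate and `n ^ c < 1` fails. [folklore] -/
theorem not_innerHypLowWindow {d : ℕ} (hd : 1 ≤ d) (c : ℕ) {k : ℕ} (hk : 2 ≤ k) {δ ε : ℝ}
    (hδ : 0 < δ) (hε : 0 < ε) :
    ¬ (∀ᶠ n : ℕ in atTop, ∀ q : ℝ, 0 ≤ q → q ≤ 1 →
        (mk n k : ℝ) * (n : ℝ) ^ (-ε) ≤ q * (n.choose 2 : ℕ) → q * (n.choose 2 : ℕ) ≤ (mk n k : ℝ) →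
        ∀ C : Circuit ((⊤ : SimpleGraph (Fin n)).edgeSet), C.IsOver acBasis → C.acDepth ≤ d →
          gnpDisagreeProb n q C.eval (cliqueFn n k) ≤ δ → n ^ c < C.size) := by
  intro h
  have hsmall : ∀ᶠ n : ℕ in atTop, (n : ℝ) ^ (-ε) < δ :=
    ((tendsto_rpow_neg_atTop hε).comp tendsto_natCast_atTop_atTop).eventually (gt_mem_nhds hδ)
  obtain ⟨n, hn, hn2, hsm⟩ := (h.and ((eventually_ge_atTop 2).and hsmall)).exists
  have hn1 : 1 ≤ n := by omega
  have hn0 : (0 : ℝ) < n := by exact_mod_cast (show 0 < n by omega)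
  have hn1r : (1 : ℝ) ≤ n := by exact_mod_cast hn1
  have hNpos : (0 : ℝ) < ((n.choose 2 : ℕ) : ℝ) := by exact_mod_cast Nat.choose_pos hn2
  set α : ℝ := 2 / ((k : ℝ) - 1) with hα
  have hnε0 : 0 ≤ (n : ℝ) ^ (-ε) := Real.rpow_nonneg hn0.le _
  have hnε1 : (n : ℝ) ^ (-ε) ≤ 1 := Real.rpow_le_one_of_one_le_of_nonpos hn1r (by linarith)
  have hm0 : (0 : ℝ) ≤ (mk n k : ℝ) := Nat.cast_nonneg _
  have hm_up : (mk n k : ℝ) ≤ (n.choose 2 : ℕ) * (n : ℝ) ^ (-α) := by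
    rw [mk, hα, neg_div]
    exact Nat.floor_le (by positivity)
  have hmN : (mk n k : ℝ) ≤ (n.choose 2 : ℕ) := by exact_mod_cast mk_le_choose hn1 hk
  -- the witness density: the lower edge of the widened window
  set q : ℝ := (mk n k : ℝ) * (n : ℝ) ^ (-ε) / (n.choose 2 : ℕ) with hq
  have hq0 : 0 ≤ q := by positivity
  have hqN : q * (n.choose 2 : ℕ) = (mk n k : ℝ) * (n : ℝ) ^ (-ε) := by
    rw [hq, div_mul_cancel₀ _ hNpos.ne']
  have hq1 : q ≤ 1 := by
    rw [hq, div_le_one hNpos]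
    calc (mk n k : ℝ) * (n : ℝ) ^ (-ε) ≤ (mk n k : ℝ) * 1 := mul_le_mul_of_nonneg_left hnε1 hm0
      _ ≤ (n.choose 2 : ℕ) := by rw [mul_one]; exact hmN
  have hwin_hi : q * (n.choose 2 : ℕ) ≤ (mk n k : ℝ) := by
    rw [hqN]
    calc (mk n k : ℝ) * (n : ℝ) ^ (-ε) ≤ (mk n k : ℝ) * 1 := mul_le_mul_of_nonneg_left hnε1 hm0
      _ = (mk n k : ℝ) := mul_one _
  -- q = b · n^{-α} with b ≤ n^{-ε}
  set b : ℝ := (mk n k : ℝ) * (n : ℝ) ^ (-ε) * (n : ℝ) ^ α / (n.choose 2 : ℕ) with hb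
  have hb0 : 0 ≤ b := by positivity
  have hqb : q = b * (n : ℝ) ^ (-(2 : ℝ) / ((k : ℝ) - 1)) := by
    rw [neg_div, ← hα, hb, hq, div_mul_eq_mul_div, mul_assoc ((mk n k : ℝ) * (n : ℝ) ^ (-ε)),
      ← Real.rpow_add hn0, add_neg_cancel, Real.rpow_zero, mul_one]
  have hb_le : b ≤ (n : ℝ) ^ (-ε) := by
    rw [hb, div_le_iff₀ hNpos]
    calc (mk n k : ℝ) * (n : ℝ) ^ (-ε) * (n : ℝ) ^ α
        ≤ ((n.choose 2 : ℕ) * (n : ℝ) ^ (-α)) * (n : ℝ) ^ (-ε) * (n : ℝ) ^ α :=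
          mul_le_mul_of_nonneg_right (mul_le_mul_of_nonneg_right hm_up hnε0) (by positivity)
      _ = (n : ℝ) ^ (-ε) * (n.choose 2 : ℕ) * ((n : ℝ) ^ (-α) * (n : ℝ) ^ α) := by ring
      _ = (n : ℝ) ^ (-ε) * (n.choose 2 : ℕ) := by
          rw [← Real.rpow_add hn0, neg_add_cancel, Real.rpow_zero, mul_one]
  have hb1 : b ≤ 1 := hb_le.trans hnε1
  -- the constant-0 circuit is δ-accurate at density q
  have herr : gnpDisagreeProb n q (Circuit.const _ false).eval (cliqueFn n k) ≤ δ := by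
    rw [gnpDisagreeProb_const_false]
    refine (gnpProb_clique_le hq0 hq1 k).trans ?_
    rw [hqb]
    refine (choose_mul_threshold_pow_le hk hn1 hb0).trans ?_
    have hK1 : 1 ≤ k.choose 2 := Nat.choose_pos hk
    calc b ^ k.choose 2 ≤ b ^ 1 := pow_le_pow_of_le_one hb0 hb1 hK1
      _ = b := pow_one b
      _ ≤ (n : ℝ) ^ (-ε) := hb_le
      _ ≤ δ := hsm.le
  have hlt := hn q hq0 hq1 (by rw [hqN]) hwin_hi (Circuit.const _ false)
    (Circuit.const_isOver_acBasis false) (by rw [Circuit.acDepth_const]; exact hd) herr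
  rw [Circuit.size_const] at hlt
  exact absurd (Nat.one_le_pow c n hn1) (not_le.2 hlt)

/-- **The global hypothesis with the `q`-window widened down to `m · n^{-ε}` is false for every
`ε > 0`** (any witness `k ≥ 3` is killed by the constant-`0` circuit at `d = 1`, `c = 0`). [folklore] -/
theorem not_hypLowWindow {ε : ℝ} (hε : 0 < ε) :
    ¬ ∀ d c : ℕ, ∃ k : ℕ, 3 ≤ k ∧ ∃ δ : ℝ, 0 < δ ∧ (∀ᶠ n : ℕ in atTop, ∀ q : ℝ, 0 ≤ q → q ≤ 1 →
        (mk n k : ℝ) * (n : ℝ) ^ (-ε) ≤ q * (n.choose 2 : ℕ) → q * (n.choose 2 : ℕ) ≤ (mk n k : ℝ) →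
        ∀ C : Circuit ((⊤ : SimpleGraph (Fin n)).edgeSet), C.IsOver acBasis → C.acDepth ≤ d →
          gnpDisagreeProb n q C.eval (cliqueFn n k) ≤ δ → n ^ c < C.size) := by
  intro h
  obtain ⟨k, hk, δ, hδ, hI⟩ := h 1 0
  exact not_innerHypLowWindow le_rfl 0 (by omega) hδ hε hI

/-- **The global conclusion with the `j`-window widened down to `m · n^{-ε}` is false for every
`ε > 0`** (Part V's `not_innerConcLowWindow` at `d = 1`, `c = 0`). [folklore] -/
theorem not_concLowWindow {ε : ℝ} (hε : 0 < ε) :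
    ¬ ∀ d c : ℕ, ∃ k : ℕ, 3 ≤ k ∧ ∃ δ : ℝ, 0 < δ ∧ (∀ᶠ n : ℕ in atTop, ∀ j : ℕ,
        (mk n k : ℝ) * (n : ℝ) ^ (-ε) ≤ j → j ≤ mk n k →
        ∀ C : Circuit ((⊤ : SimpleGraph (Fin n)).edgeSet), C.IsOver acBasis → C.acDepth ≤ d →
          (sliceErr n j C.eval (cliqueFn n k) : ℝ) ≤ δ * sliceCard n j → n ^ c < C.size) := by
  intro h
  obtain ⟨k, hk, δ, hδ, hI⟩ := h 1 0
  exact not_innerConcLowWindow le_rfl 0 hk hδ hε hI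

end LowWindowHyp

end Summit.PneNP.PneNP.Theorems.SliceACZero.Negative

end
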